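import Summits.CriticalPhenomena.PercolationContinuityZ3.Theorems.SahiMasterFamilyThreePartitionTypedSlice
import HarnessLib

/-!
# The TYPED SLICE of the twisted three-partition functional at a coordinate, II: the slicing theorem, typed Kleitman atoms,
# and the certificate checker (unit `prim-master-conj`, gen 34; `--supports stmt-CriticalPhenomena-4575`)

Companion of `…ThreePartitionTypedSlice` (memo `run/shared/lean/prim/prim-l12/prim-master-conj/POINTWISE.md` §34–35).
* SLICING (`tri_slice`, `threePartNT_eq_tsumP`): for ANY three families whose membership is read from (bit `[e ∈ x]`, type of `x`)
  by Boolean readers `RU RV RW`, `threePartNT τ 𝒳U 𝒳V 𝒳W = tsumP (kappaR RU RV RW β)` with `β = [e ∈ τ]`, where `kappaR` sums the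
  Richards–Sahi pattern `kerK = 2[c ∈ U∩V∩W] + [a∈U][b∈V][c∈W] − Σ_cyc [a∈U][c∈V∩W]` (the shape of `threePartNT`) over the three
  positions of `e` (`tri_split` + `tri_move12/32` of `…ThreePartitionLift`; position `i` carries the bit `¬β`).  Instances: the triple
  itself (`kappa`, `threePartNT_eq_tsumP_kappa`, readers `rd`) and the `e`-free lift of the DELETION-section triple
  `{T | T ∖ e ∈ 𝒳}` (`threePartNT_deletion_eq_tsumP`: `= 3 · tsumP atomDel`).
* TYPED KLEITMAN (`tri_kleitman_spec`, `tsumP_atomKLg_nonneg`, `tsumP_atomKL_nonneg`): for Boolean type families inducing up-sets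
  (e.g. principal type-up-sets `{t | t ≥ th}`) and any test `σ` on the spectator's type,
  `Σ [σ(t_b)]([t_c ∈ Y ∩ Z] − [t_a ∈ Y][t_c ∈ Z]) ≥ 0` — the tree's `teeT_le_deeT` (fibrewise four functions) with the typed first
  family `{x | φ (x ∆ τ)}`.
* CHECKER (`check`, `check_spec`, `tsumP_nonneg_of_check`): a certificate `κ − Σ λ·atoms =: r` is accepted when the six-fold
  symmetrisation of `r` is `≥ 0` on every SORTED triple of class types (the pinned type counts are symmetric, so this is
  "coefficientwise on type multisets"); then `tsumP r ≥ 0` whenever all realised types lie in the class.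
No `sorry`, standard axioms.  HONEST LABEL: a framework — it proves nothing about the crux by itself. [this work]
-/

noncomputable section

open Finset
open scoped symmDiff Classical

namespace Summit.CriticalPhenomena.PercolationContinuityZ3.Theorems.ThreePartition

namespace TypedSlice

variable {ι : Type*}

/-! ## Slicing the twisted functional at `e` -/

section Slice

variable [Fintype ι] (𝒰 𝒱 𝒲 : Set (Set ι)) (e : ι) (τ : Set ι)

omit [Fintype ι] in
/-- If `e ∈ X` then `e ∈ X ∆ τ ↔ e ∉ τ` (as bits). [folklore] -/
theorem decide_symmDiff_of_mem {e : ι} {X : Set ι} (τ : Set ι) (h : e ∈ X) :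
    decide (e ∈ X ∆ τ) = !decide (e ∈ τ) := by
  by_cases hτ : e ∈ τ <;> simp [Set.mem_symmDiff, h, hτ]

omit [Fintype ι] in
/-- If `e ∉ X` then `e ∈ X ∆ τ ↔ e ∈ τ` (as bits). [folklore] -/
theorem decide_symmDiff_of_not_mem {e : ι} {X : Set ι} (τ : Set ι) (h : e ∉ X) :
    decide (e ∈ X ∆ τ) = decide (e ∈ τ) := by
  by_cases hτ : e ∈ τ <;> simp [Set.mem_symmDiff, h, hτ]

/-- **General slicing of a twisted count.**  A count whose predicate only reads, for each copy, the bit `[e ∈ copy]` and the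
type triple, is the pinned sum of its indicator over the three positions of `e` (position `i`: copy `i` carries the bit
`¬β`, the other two the bit `β = [e ∈ τ]`). [this work] -/
theorem tri_slice (G : Bool → Ty → Bool → Ty → Bool → Ty → Bool) :
    ((tri fun S₁ S₂ S₃ => G (decide (e ∈ S₁ ∆ τ)) (typ 𝒰 𝒱 𝒲 e (S₁ ∆ τ)) (decide (e ∈ S₂ ∆ τ)) (typ 𝒰 𝒱 𝒲 e (S₂ ∆ τ))
        (decide (e ∈ S₃ ∆ τ)) (typ 𝒰 𝒱 𝒲 e (S₃ ∆ τ)) = true : ℕ) : ℤ)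
      = tsumP 𝒰 𝒱 𝒲 e τ (fun ta tb tc =>
          bz (G (!decide (e ∈ τ)) ta (decide (e ∈ τ)) tb (decide (e ∈ τ)) tc)
          + bz (G (decide (e ∈ τ)) ta (!decide (e ∈ τ)) tb (decide (e ∈ τ)) tc)
          + bz (G (decide (e ∈ τ)) ta (decide (e ∈ τ)) tb (!decide (e ∈ τ)) tc)) := by
  have h1 : tri (fun S₁ S₂ S₃ => e ∈ S₁ ∧ G (decide (e ∈ S₁ ∆ τ)) (typ 𝒰 𝒱 𝒲 e (S₁ ∆ τ)) (decide (e ∈ S₂ ∆ τ))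
        (typ 𝒰 𝒱 𝒲 e (S₂ ∆ τ)) (decide (e ∈ S₃ ∆ τ)) (typ 𝒰 𝒱 𝒲 e (S₃ ∆ τ)) = true)
      = tri (fun S₁ S₂ S₃ => e ∈ S₂ ∧ (fun ta tb tc => G (!decide (e ∈ τ)) ta (decide (e ∈ τ)) tb (decide (e ∈ τ)) tc)
        (typ 𝒰 𝒱 𝒲 e (S₁ ∆ τ)) (typ 𝒰 𝒱 𝒲 e (S₂ ∆ τ)) (typ 𝒰 𝒱 𝒲 e (S₃ ∆ τ)) = true) := by
    rw [tri_move12]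
    refine tri_congr fun S₁ S₂ hd => and_congr_right fun he => ?_
    have he1 : e ∈ insert e S₁ := Set.mem_insert e S₁
    have he2 : e ∉ S₂ \ {e} := fun h => h.2 rfl
    have he3 : e ∉ (S₁ ∪ S₂)ᶜ := fun h => h (Or.inr he)
    simp only [decide_symmDiff_of_mem τ he1, decide_symmDiff_of_not_mem τ he2, decide_symmDiff_of_not_mem τ he3,
      typ_insert_symmDiff, typ_sdiff_symmDiff]
  have h2 : tri (fun S₁ S₂ S₃ => e ∈ S₂ ∧ G (decide (e ∈ S₁ ∆ τ)) (typ 𝒰 𝒱 𝒲 e (S₁ ∆ τ)) (decide (e ∈ S₂ ∆ τ))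
        (typ 𝒰 𝒱 𝒲 e (S₂ ∆ τ)) (decide (e ∈ S₃ ∆ τ)) (typ 𝒰 𝒱 𝒲 e (S₃ ∆ τ)) = true)
      = tri (fun S₁ S₂ S₃ => e ∈ S₂ ∧ (fun ta tb tc => G (decide (e ∈ τ)) ta (!decide (e ∈ τ)) tb (decide (e ∈ τ)) tc)
        (typ 𝒰 𝒱 𝒲 e (S₁ ∆ τ)) (typ 𝒰 𝒱 𝒲 e (S₂ ∆ τ)) (typ 𝒰 𝒱 𝒲 e (S₃ ∆ τ)) = true) := by
    refine tri_congr fun S₁ S₂ hd => and_congr_right fun he => ?_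
    have he1 : e ∉ S₁ := fun h => Set.disjoint_left.1 hd h he
    have he3 : e ∉ (S₁ ∪ S₂)ᶜ := fun h => h (Or.inr he)
    simp only [decide_symmDiff_of_not_mem τ he1, decide_symmDiff_of_mem τ he, decide_symmDiff_of_not_mem τ he3]
  have h3 : tri (fun S₁ S₂ S₃ => e ∈ S₃ ∧ G (decide (e ∈ S₁ ∆ τ)) (typ 𝒰 𝒱 𝒲 e (S₁ ∆ τ)) (decide (e ∈ S₂ ∆ τ))
        (typ 𝒰 𝒱 𝒲 e (S₂ ∆ τ)) (decide (e ∈ S₃ ∆ τ)) (typ 𝒰 𝒱 𝒲 e (S₃ ∆ τ)) = true)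
      = tri (fun S₁ S₂ S₃ => e ∈ S₂ ∧ (fun ta tb tc => G (decide (e ∈ τ)) ta (decide (e ∈ τ)) tb (!decide (e ∈ τ)) tc)
        (typ 𝒰 𝒱 𝒲 e (S₁ ∆ τ)) (typ 𝒰 𝒱 𝒲 e (S₂ ∆ τ)) (typ 𝒰 𝒱 𝒲 e (S₃ ∆ τ)) = true) := by
    rw [tri_move32]
    refine tri_congr fun S₁ S₂ hd => and_congr_right fun he => ?_
    have he1 : e ∉ S₁ := fun h => Set.disjoint_left.1 hd h he
    have he2 : e ∉ S₂ \ {e} := fun h => h.2 rfl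
    have he3 : e ∈ insert e (S₁ ∪ S₂)ᶜ := Set.mem_insert e _
    simp only [decide_symmDiff_of_not_mem τ he1, decide_symmDiff_of_not_mem τ he2, decide_symmDiff_of_mem τ he3,
      typ_insert_symmDiff, typ_sdiff_symmDiff]
  have hs := tri_split e (fun S₁ S₂ S₃ => G (decide (e ∈ S₁ ∆ τ)) (typ 𝒰 𝒱 𝒲 e (S₁ ∆ τ)) (decide (e ∈ S₂ ∆ τ))
        (typ 𝒰 𝒱 𝒲 e (S₂ ∆ τ)) (decide (e ∈ S₃ ∆ τ)) (typ 𝒰 𝒱 𝒲 e (S₃ ∆ τ)) = true)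
  rw [h1, h2, h3] at hs
  rw [hs]
  push_cast
  rw [tri_pin_eq_tsumP 𝒰 𝒱 𝒲 e τ (fun ta tb tc => G (!decide (e ∈ τ)) ta (decide (e ∈ τ)) tb (decide (e ∈ τ)) tc),
    tri_pin_eq_tsumP 𝒰 𝒱 𝒲 e τ (fun ta tb tc => G (decide (e ∈ τ)) ta (!decide (e ∈ τ)) tb (decide (e ∈ τ)) tc),
    tri_pin_eq_tsumP 𝒰 𝒱 𝒲 e τ (fun ta tb tc => G (decide (e ∈ τ)) ta (decide (e ∈ τ)) tb (!decide (e ∈ τ)) tc),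
    tsumP_add, tsumP_add]

/-- The Richards–Sahi three-partition PATTERN on one ordered partition, from the membership bits of the copies:
`2[c ∈ U∩V∩W] + [a∈U][b∈V][c∈W] − [a∈U][c∈V∩W] − [a∈V][c∈U∩W] − [a∈W][c∈U∩V]` (the shape of `threePartNT`). [this work] -/
def kerK (aU aV aW bV cU cV cW : Bool) : ℤ :=
  2 * bz (cU && (cV && cW)) + bz (aU && (bV && cW)) - bz (aU && (cV && cW)) - bz (aV && (cU && cW)) - bz (aW && (cU && cV))

/-- The SLICED KERNEL for membership readers `RU, RV, RW : (bit, type) → Bool`: the pattern `kerK` summed over the three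
positions of `e` (position `i` carries the bit `¬β`). [this work] -/
def kappaR (RU RV RW : Bool → Ty → Bool) (β : Bool) (ta tb tc : Ty) : ℤ :=
  kerK (RU (!β) ta) (RV (!β) ta) (RW (!β) ta) (RV β tb) (RU β tc) (RV β tc) (RW β tc)
  + kerK (RU β ta) (RV β ta) (RW β ta) (RV (!β) tb) (RU β tc) (RV β tc) (RW β tc)
  + kerK (RU β ta) (RV β ta) (RW β ta) (RV β tb) (RU (!β) tc) (RV (!β) tc) (RW (!β) tc)

/-- Linear bookkeeping for the five counts of `threePartNT`. [this work] -/
theorem tsumP_comb (f g h₁ h₂ h₃ : Ty → Ty → Ty → ℤ) :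
    2 * tsumP 𝒰 𝒱 𝒲 e τ f + tsumP 𝒰 𝒱 𝒲 e τ g - (tsumP 𝒰 𝒱 𝒲 e τ h₁ + tsumP 𝒰 𝒱 𝒲 e τ h₂ + tsumP 𝒰 𝒱 𝒲 e τ h₃)
      = tsumP 𝒰 𝒱 𝒲 e τ (fun a b c => 2 * f a b c + g a b c - (h₁ a b c + h₂ a b c + h₃ a b c)) := by
  simp only [tsumP, Finset.mul_sum, ← Finset.sum_add_distrib, ← Finset.sum_sub_distrib]

/-- **SLICING THEOREM.**  If membership in each of three families is read from (bit `[e ∈ x]`, type of `x`) by Boolean readers,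
then the twisted three-partition functional of the three families is the pinned sum of the sliced kernel. [this work] -/
theorem threePartNT_eq_tsumP {𝒳U 𝒳V 𝒳W : Set (Set ι)} (RU RV RW : Bool → Ty → Bool)
    (hU : ∀ (x : Set ι) (b : Bool), (e ∈ x ↔ b = true) → (x ∈ 𝒳U ↔ RU b (typ 𝒰 𝒱 𝒲 e x) = true))
    (hV : ∀ (x : Set ι) (b : Bool), (e ∈ x ↔ b = true) → (x ∈ 𝒳V ↔ RV b (typ 𝒰 𝒱 𝒲 e x) = true))
    (hW : ∀ (x : Set ι) (b : Bool), (e ∈ x ↔ b = true) → (x ∈ 𝒳W ↔ RW b (typ 𝒰 𝒱 𝒲 e x) = true)) :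
    threePartNT τ 𝒳U 𝒳V 𝒳W = tsumP 𝒰 𝒱 𝒲 e τ (kappaR RU RV RW (decide (e ∈ τ))) := by
  have hU' : ∀ x, x ∈ 𝒳U ↔ RU (decide (e ∈ x)) (typ 𝒰 𝒱 𝒲 e x) = true := fun x => hU x _ decide_eq_true_iff.symm
  have hV' : ∀ x, x ∈ 𝒳V ↔ RV (decide (e ∈ x)) (typ 𝒰 𝒱 𝒲 e x) = true := fun x => hV x _ decide_eq_true_iff.symm
  have hW' : ∀ x, x ∈ 𝒳W ↔ RW (decide (e ∈ x)) (typ 𝒰 𝒱 𝒲 e x) = true := fun x => hW x _ decide_eq_true_iff.symm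
  have hTop := tri_slice 𝒰 𝒱 𝒲 e τ (fun _ _ _ _ b₃ t₃ => RU b₃ t₃ && (RV b₃ t₃ && RW b₃ t₃))
  have hTee := tri_slice 𝒰 𝒱 𝒲 e τ (fun b₁ t₁ b₂ t₂ b₃ t₃ => RU b₁ t₁ && (RV b₂ t₂ && RW b₃ t₃))
  have hD1 := tri_slice 𝒰 𝒱 𝒲 e τ (fun b₁ t₁ _ _ b₃ t₃ => RU b₁ t₁ && (RV b₃ t₃ && RW b₃ t₃))
  have hD2 := tri_slice 𝒰 𝒱 𝒲 e τ (fun b₁ t₁ _ _ b₃ t₃ => RV b₁ t₁ && (RU b₃ t₃ && RW b₃ t₃))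
  have hD3 := tri_slice 𝒰 𝒱 𝒲 e τ (fun b₁ t₁ _ _ b₃ t₃ => RW b₁ t₁ && (RU b₃ t₃ && RV b₃ t₃))
  have eTop : topT τ (𝒳U ∩ 𝒳V ∩ 𝒳W) = tri (fun S₁ S₂ S₃ => (fun (_ : Bool) (_ : Ty) (_ : Bool) (_ : Ty) b₃ t₃ =>
      RU b₃ t₃ && (RV b₃ t₃ && RW b₃ t₃)) (decide (e ∈ S₁ ∆ τ)) (typ 𝒰 𝒱 𝒲 e (S₁ ∆ τ)) (decide (e ∈ S₂ ∆ τ))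
      (typ 𝒰 𝒱 𝒲 e (S₂ ∆ τ)) (decide (e ∈ S₃ ∆ τ)) (typ 𝒰 𝒱 𝒲 e (S₃ ∆ τ)) = true) := by
    unfold topT triT
    exact tri_congr fun _ _ _ => by simp only [Set.mem_inter_iff, hU', hV', hW', Bool.and_eq_true, and_assoc]
  have eTee : teeT τ 𝒳U 𝒳V 𝒳W = tri (fun S₁ S₂ S₃ => (fun b₁ t₁ b₂ t₂ b₃ t₃ => RU b₁ t₁ && (RV b₂ t₂ && RW b₃ t₃))
      (decide (e ∈ S₁ ∆ τ)) (typ 𝒰 𝒱 𝒲 e (S₁ ∆ τ)) (decide (e ∈ S₂ ∆ τ)) (typ 𝒰 𝒱 𝒲 e (S₂ ∆ τ)) (decide (e ∈ S₃ ∆ τ))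
      (typ 𝒰 𝒱 𝒲 e (S₃ ∆ τ)) = true) := by
    unfold teeT triT
    exact tri_congr fun _ _ _ => by simp only [hU', hV', hW', Bool.and_eq_true]
  have eD1 : deeT τ 𝒳U (𝒳V ∩ 𝒳W) = tri (fun S₁ S₂ S₃ => (fun b₁ t₁ (_ : Bool) (_ : Ty) b₃ t₃ =>
      RU b₁ t₁ && (RV b₃ t₃ && RW b₃ t₃)) (decide (e ∈ S₁ ∆ τ)) (typ 𝒰 𝒱 𝒲 e (S₁ ∆ τ)) (decide (e ∈ S₂ ∆ τ))
      (typ 𝒰 𝒱 𝒲 e (S₂ ∆ τ)) (decide (e ∈ S₃ ∆ τ)) (typ 𝒰 𝒱 𝒲 e (S₃ ∆ τ)) = true) := by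
    unfold deeT triT
    exact tri_congr fun _ _ _ => by simp only [Set.mem_inter_iff, hU', hV', hW', Bool.and_eq_true]
  have eD2 : deeT τ 𝒳V (𝒳U ∩ 𝒳W) = tri (fun S₁ S₂ S₃ => (fun b₁ t₁ (_ : Bool) (_ : Ty) b₃ t₃ =>
      RV b₁ t₁ && (RU b₃ t₃ && RW b₃ t₃)) (decide (e ∈ S₁ ∆ τ)) (typ 𝒰 𝒱 𝒲 e (S₁ ∆ τ)) (decide (e ∈ S₂ ∆ τ))
      (typ 𝒰 𝒱 𝒲 e (S₂ ∆ τ)) (decide (e ∈ S₃ ∆ τ)) (typ 𝒰 𝒱 𝒲 e (S₃ ∆ τ)) = true) := by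
    unfold deeT triT
    exact tri_congr fun _ _ _ => by simp only [Set.mem_inter_iff, hU', hV', hW', Bool.and_eq_true]
  have eD3 : deeT τ 𝒳W (𝒳U ∩ 𝒳V) = tri (fun S₁ S₂ S₃ => (fun b₁ t₁ (_ : Bool) (_ : Ty) b₃ t₃ =>
      RW b₁ t₁ && (RU b₃ t₃ && RV b₃ t₃)) (decide (e ∈ S₁ ∆ τ)) (typ 𝒰 𝒱 𝒲 e (S₁ ∆ τ)) (decide (e ∈ S₂ ∆ τ))
      (typ 𝒰 𝒱 𝒲 e (S₂ ∆ τ)) (decide (e ∈ S₃ ∆ τ)) (typ 𝒰 𝒱 𝒲 e (S₃ ∆ τ)) = true) := by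
    unfold deeT triT
    exact tri_congr fun _ _ _ => by simp only [Set.mem_inter_iff, hU', hV', hW', Bool.and_eq_true]
  unfold threePartNT
  rw [eTop, eTee, eD1, eD2, eD3]
  push_cast
  rw [hTop, hTee, hD1, hD2, hD3, tsumP_comb]
  exact tsumP_congr 𝒰 𝒱 𝒲 e τ fun ta tb tc => by simp only [kappaR, kerK]; ring

/-- Readers that ignore the bit give three equal positions. [this work] -/
theorem kappaR_const (FU FV FW : Ty → Bool) (β : Bool) (ta tb tc : Ty) :
    kappaR (fun _ t => FU t) (fun _ t => FV t) (fun _ t => FW t) β ta tb tc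
      = 3 * kerK (FU ta) (FV ta) (FW ta) (FV tb) (FU tc) (FV tc) (FW tc) := by
  simp only [kappaR]; ring

/-- The sliced kernel of the triple `(𝒰, 𝒱, 𝒲)` itself (memberships read by `rd`). [this work] -/
def kappa (β : Bool) : Ty → Ty → Ty → ℤ :=
  kappaR (fun b t => rd b t.1) (fun b t => rd b t.2.1) (fun b t => rd b t.2.2) β

/-- **`threePartNT τ 𝒰 𝒱 𝒲` is the pinned sum of `kappa`** (for up-sets). [this work] -/
theorem threePartNT_eq_tsumP_kappa (h𝒰 : IsUpperSet 𝒰) (h𝒱 : IsUpperSet 𝒱) (h𝒲 : IsUpperSet 𝒲) :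
    threePartNT τ 𝒰 𝒱 𝒲 = tsumP 𝒰 𝒱 𝒲 e τ (kappa (decide (e ∈ τ))) :=
  threePartNT_eq_tsumP 𝒰 𝒱 𝒲 e τ (fun b t => rd b t.1) (fun b t => rd b t.2.1) (fun b t => rd b t.2.2)
    (fun x b hb => mem_iff_rd h𝒰 e x b hb) (fun x b hb => mem_iff_rd h𝒱 e x b hb) (fun x b hb => mem_iff_rd h𝒲 e x b hb)

/-- The pattern of the DELETION-SECTION triple `(𝒰⁰, 𝒱⁰, 𝒲⁰)` (levels `= 2`), one position. [this work] -/
def atomDel (ta tb tc : Ty) : ℤ :=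
  kerK (decide (ta.1 = 2)) (decide (ta.2.1 = 2)) (decide (ta.2.2 = 2)) (decide (tb.2.1 = 2))
    (decide (tc.1 = 2)) (decide (tc.2.1 = 2)) (decide (tc.2.2 = 2))

/-- **The deletion-section triple, lifted `e`-free to `ι`, slices to `3 · tsumP atomDel`.** [this work] -/
theorem threePartNT_deletion_eq_tsumP :
    threePartNT τ {T : Set ι | T \ {e} ∈ 𝒰} {T : Set ι | T \ {e} ∈ 𝒱} {T : Set ι | T \ {e} ∈ 𝒲}
      = 3 * tsumP 𝒰 𝒱 𝒲 e τ atomDel := by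
  rw [threePartNT_eq_tsumP 𝒰 𝒱 𝒲 e τ (fun _ t => decide (t.1 = 2)) (fun _ t => decide (t.2.1 = 2))
    (fun _ t => decide (t.2.2 = 2)), ← tsumP_const_mul]
  · exact tsumP_congr 𝒰 𝒱 𝒲 e τ fun ta tb tc => by rw [kappaR_const]; rfl
  · intro x _ _; simp only [Set.mem_setOf_eq, decide_eq_true_eq, typ, tyAt_eq_two_iff]
  · intro x _ _; simp only [Set.mem_setOf_eq, decide_eq_true_eq, typ, tyAt_eq_two_iff]
  · intro x _ _; simp only [Set.mem_setOf_eq, decide_eq_true_eq, typ, tyAt_eq_two_iff]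

/-! ## Typed Kleitman -/

/-- **Kleitman with a typed spectator**: for ANY condition `φ` on the second part and up-sets `𝒜, ℬ`, merging the requirements
of parts 1 and 3 onto part 3 does not decrease the twisted count (the tree's `teeT_le_deeT` with first family
`{x | φ (x ∆ τ)}`, parts 1 and 2 swapped). [this work] -/
theorem tri_kleitman_spec (φ : Set ι → Prop) {𝒜 ℬ : Set (Set ι)} (h𝒜 : IsUpperSet 𝒜) (hℬ : IsUpperSet ℬ) :
    tri (fun S₁ S₂ S₃ => φ S₂ ∧ (S₁ ∆ τ ∈ 𝒜 ∧ S₃ ∆ τ ∈ ℬ)) ≤ tri (fun _ S₂ S₃ => φ S₂ ∧ S₃ ∆ τ ∈ 𝒜 ∩ ℬ) := by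
  have h := teeT_le_deeT τ {x : Set ι | φ (x ∆ τ)} h𝒜 hℬ
  unfold teeT deeT triT at h
  calc tri (fun S₁ S₂ S₃ => φ S₂ ∧ (S₁ ∆ τ ∈ 𝒜 ∧ S₃ ∆ τ ∈ ℬ))
      = tri (fun S₁ S₂ S₃ => S₁ ∆ τ ∈ {x : Set ι | φ (x ∆ τ)} ∧ S₂ ∆ τ ∈ 𝒜 ∧ S₃ ∆ τ ∈ ℬ) := by
        rw [tri_swap12]
        exact tri_congr fun _ _ _ => by simp only [Set.mem_setOf_eq, symmDiff_symmDiff_cancel_right]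
    _ ≤ tri (fun S₁ S₂ S₃ => S₁ ∆ τ ∈ {x : Set ι | φ (x ∆ τ)} ∧ S₃ ∆ τ ∈ 𝒜 ∩ ℬ) := h
    _ = tri (fun S₁ S₂ S₃ => φ S₂ ∧ S₃ ∆ τ ∈ 𝒜 ∩ ℬ) := by
        rw [tri_swap12]
        exact tri_congr fun _ _ _ => by simp only [Set.mem_setOf_eq, symmDiff_symmDiff_cancel_right]

/-- The TYPED KLEITMAN integrand for Boolean type families `FY, FZ` and a spectator test `σ`:
`[σ(t_b)]·([t_c ∈ FY ∩ FZ] − [t_a ∈ FY][t_c ∈ FZ])`. [this work] -/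
def atomKLg (σ FY FZ : Ty → Bool) (ta tb tc : Ty) : ℤ :=
  bz (σ tb && (FY tc && FZ tc)) - bz (σ tb && (FY ta && FZ tc))

/-- **Typed Kleitman integrands are nonnegative** whenever the two type families induce up-sets of sets. [this work] -/
theorem tsumP_atomKLg_nonneg (σ FY FZ : Ty → Bool) (hY : IsUpperSet {w : Set ι | FY (typ 𝒰 𝒱 𝒲 e w) = true})
    (hZ : IsUpperSet {w : Set ι | FZ (typ 𝒰 𝒱 𝒲 e w) = true}) : 0 ≤ tsumP 𝒰 𝒱 𝒲 e τ (atomKLg σ FY FZ) := by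
  have hK := tri_kleitman_spec τ (fun S₂ => e ∈ S₂ ∧ σ (typ 𝒰 𝒱 𝒲 e (S₂ ∆ τ)) = true) hY hZ
  have hL : tri (fun S₁ S₂ S₃ => (e ∈ S₂ ∧ σ (typ 𝒰 𝒱 𝒲 e (S₂ ∆ τ)) = true) ∧
        (S₁ ∆ τ ∈ {w : Set ι | FY (typ 𝒰 𝒱 𝒲 e w) = true} ∧ S₃ ∆ τ ∈ {w : Set ι | FZ (typ 𝒰 𝒱 𝒲 e w) = true}))
      = tri (fun S₁ S₂ S₃ => e ∈ S₂ ∧ (fun ta tb tc => σ tb && (FY ta && FZ tc))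
        (typ 𝒰 𝒱 𝒲 e (S₁ ∆ τ)) (typ 𝒰 𝒱 𝒲 e (S₂ ∆ τ)) (typ 𝒰 𝒱 𝒲 e (S₃ ∆ τ)) = true) :=
    tri_congr fun _ _ _ => by simp only [Set.mem_setOf_eq, Bool.and_eq_true, and_assoc]
  have hR : tri (fun S₁ S₂ S₃ => (e ∈ S₂ ∧ σ (typ 𝒰 𝒱 𝒲 e (S₂ ∆ τ)) = true) ∧
        S₃ ∆ τ ∈ {w : Set ι | FY (typ 𝒰 𝒱 𝒲 e w) = true} ∩ {w : Set ι | FZ (typ 𝒰 𝒱 𝒲 e w) = true})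
      = tri (fun S₁ S₂ S₃ => e ∈ S₂ ∧ (fun ta tb tc => σ tb && (FY tc && FZ tc))
        (typ 𝒰 𝒱 𝒲 e (S₁ ∆ τ)) (typ 𝒰 𝒱 𝒲 e (S₂ ∆ τ)) (typ 𝒰 𝒱 𝒲 e (S₃ ∆ τ)) = true) :=
    tri_congr fun _ _ _ => by simp only [Set.mem_setOf_eq, Set.mem_inter_iff, Bool.and_eq_true, and_assoc]
  rw [hL, hR] at hK
  have hK' := Int.ofNat_le.2 hK
  push_cast at hK'
  rw [tri_pin_eq_tsumP 𝒰 𝒱 𝒲 e τ (fun ta tb tc => σ tb && (FY ta && FZ tc)),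
    tri_pin_eq_tsumP 𝒰 𝒱 𝒲 e τ (fun ta tb tc => σ tb && (FY tc && FZ tc))] at hK'
  unfold atomKLg
  rw [tsumP_sub]
  linarith

/-- The TYPED KLEITMAN atom `KL[σ](X_{th₁}, X_{th₂})` for principal type-up-sets:
`[σ(t_b)]·([t_c ≥ th₁, th₂] − [t_a ≥ th₁][t_c ≥ th₂])`. [this work] -/
def atomKL (σ : Ty → Bool) (th₁ th₂ : Ty) : Ty → Ty → Ty → ℤ := atomKLg σ (fun t => ge3 t th₁) (fun t => ge3 t th₂)

/-- **Typed Kleitman atoms are nonnegative** for up-sets `𝒰, 𝒱, 𝒲`, every spectator test and all thresholds. [this work] -/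
theorem tsumP_atomKL_nonneg (h𝒰 : IsUpperSet 𝒰) (h𝒱 : IsUpperSet 𝒱) (h𝒲 : IsUpperSet 𝒲) (σ : Ty → Bool) (th₁ th₂ : Ty) :
    0 ≤ tsumP 𝒰 𝒱 𝒲 e τ (atomKL σ th₁ th₂) :=
  tsumP_atomKLg_nonneg 𝒰 𝒱 𝒲 e τ σ _ _ (isUpperSet_ge3 h𝒰 h𝒱 h𝒲 e th₁) (isUpperSet_ge3 h𝒰 h𝒱 h𝒲 e th₂)

end Slice


/-! ## The certificate checker (sorted class triples, six-fold symmetrised residual) -/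

section Checker

/-- The three levels. [this work] -/
def f3 : List (Fin 3) := [0, 1, 2]

/-- All 27 types. [this work] -/
def tyList : List Ty := f3.flatMap fun a => f3.flatMap fun b => f3.map fun c => (a, b, c)

/-- Every type is listed. [this work] -/
theorem mem_tyList (t : Ty) : t ∈ tyList := by
  obtain ⟨a, b, c⟩ := t
  fin_cases a <;> fin_cases b <;> fin_cases c <;> decide

/-- Linear index of a type (to enumerate each multiset of three types once). [this work] -/
def idx (t : Ty) : ℕ := 9 * t.1.val + 3 * t.2.1.val + t.2.2.val

/-- Partial certificate check: first type restricted to the list `tas`. [this work] -/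
def checkL (cls : Ty → Bool) (r : Ty → Ty → Ty → ℤ) (tas : List Ty) : Bool :=
  tas.all fun ta => tyList.all fun tb => tyList.all fun tc =>
    !(cls ta && (cls tb && (cls tc && (decide (idx ta ≤ idx tb) && decide (idx tb ≤ idx tc)))))
      || decide (0 ≤ sym6 r ta tb tc)

/-- **CERTIFICATE CHECKER**: for every SORTED triple of types in the class `cls`, the six-fold symmetrisation of the residual
`r` is nonnegative. [this work] -/
def check (cls : Ty → Bool) (r : Ty → Ty → Ty → ℤ) : Bool := checkL cls r tyList

/-- Splitting a check along the first type (for kernel evaluation in pieces). [this work] -/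
theorem checkL_append (cls : Ty → Bool) (r : Ty → Ty → Ty → ℤ) (l₁ l₂ : List Ty) :
    checkL cls r (l₁ ++ l₂) = (checkL cls r l₁ && checkL cls r l₂) := by
  unfold checkL; exact List.all_append

/-- `sym6` is symmetric (parts 1, 2). [this work] -/
theorem sym6_swap12 (f : Ty → Ty → Ty → ℤ) (a b c : Ty) : sym6 f b a c = sym6 f a b c := by
  simp only [sym6]; ring

/-- `sym6` is symmetric (parts 2, 3). [this work] -/
theorem sym6_swap23 (f : Ty → Ty → Ty → ℤ) (a b c : Ty) : sym6 f a c b = sym6 f a b c := by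
  simp only [sym6]; ring

/-- `sym6` is symmetric (parts 1, 3). [this work] -/
theorem sym6_swap13 (f : Ty → Ty → Ty → ℤ) (a b c : Ty) : sym6 f c b a = sym6 f a b c := by
  simp only [sym6]; ring

/-- **Soundness of the checker**: `check cls r → sym6 r ≥ 0` on ALL class triples. [this work] -/
theorem check_spec {cls : Ty → Bool} {r : Ty → Ty → Ty → ℤ} (h : check cls r = true) (ta tb tc : Ty)
    (ha : cls ta = true) (hb : cls tb = true) (hc : cls tc = true) : 0 ≤ sym6 r ta tb tc := by
  have H : ∀ x y z : Ty, cls x = true → cls y = true → cls z = true → idx x ≤ idx y → idx y ≤ idx z →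
      0 ≤ sym6 r x y z := by
    intro x y z hx hy hz hxy hyz
    have h' := h
    unfold check checkL at h'
    simp only [List.all_eq_true] at h'
    have hh := h' x (mem_tyList x) y (mem_tyList y) z (mem_tyList z)
    simpa [hx, hy, hz, hxy, hyz] using hh
  rcases le_total (idx ta) (idx tb) with h1 | h1 <;> rcases le_total (idx tb) (idx tc) with h2 | h2 <;>
    rcases le_total (idx ta) (idx tc) with h3 | h3
  · exact H _ _ _ ha hb hc h1 h2
  · exact H _ _ _ ha hb hc h1 h2
  · have := H _ _ _ ha hc hb h3 h2; rwa [sym6_swap23] at this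
  · have := H _ _ _ hc ha hb h3 h1; rwa [sym6_swap12, sym6_swap23] at this
  · have := H _ _ _ hb ha hc h1 h3; rwa [sym6_swap12] at this
  · have := H _ _ _ hb hc ha h2 h3; rwa [sym6_swap23, sym6_swap12] at this
  · have := H _ _ _ hc hb ha h2 h1; rwa [sym6_swap13] at this
  · have := H _ _ _ hc hb ha h2 h1; rwa [sym6_swap13] at this

/-- **From a checked certificate to the pinned sum**: if every realised type is in the class and the checker accepts `r`, then
`tsumP r ≥ 0`. [this work] -/
theorem tsumP_nonneg_of_check [Fintype ι] (𝒰 𝒱 𝒲 : Set (Set ι)) (e : ι) (τ : Set ι) {cls : Ty → Bool}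
    {r : Ty → Ty → Ty → ℤ} (h : check cls r = true) (hcls : ∀ w : Set ι, cls (typ 𝒰 𝒱 𝒲 e w) = true) :
    0 ≤ tsumP 𝒰 𝒱 𝒲 e τ r :=
  tsumP_nonneg_of_sym6 𝒰 𝒱 𝒲 e τ cls hcls fun ta tb tc ha hb hc => check_spec h ta tb tc ha hb hc

/-- Type literal. [this work] -/
def mk (a b c : Fin 3) : Ty := (a, b, c)

/-- Spectator test "any type". [this work] -/
def anyT : Ty → Bool := fun _ => true

/-- Spectator test "exactly the type `s`". [this work] -/
def isT (s : Ty) : Ty → Bool := fun t => decide (t = s)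

end Checker

end TypedSlice

end Summit.CriticalPhenomena.PercolationContinuityZ3.Theorems.ThreePartition

/-! ## Appendix: certificates serve sub-classes

A certificate accepted by the checker on a class of types is accepted on every sub-class (the checker only tests
sorted triples of CLASS types), so one kernel-checked residual serves all smaller classes at once
(memo POINTWISE §34.2 "monotone: a certificate for a class serves all its sub-classes"). -/

namespace Summit.CriticalPhenomena.PercolationContinuityZ3.Theorems.ThreePartition.TypedSlice

/-- **Partial checks are antitone in the class**: if `checkL cls r tas` accepts, so does `checkL cls' r tas` for every
sub-class `cls' ⊆ cls`. [this work] -/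
theorem checkL_mono {cls cls' : Ty → Bool} (hsub : ∀ t, cls' t = true → cls t = true) (r : Ty → Ty → Ty → ℤ)
    (tas : List Ty) (h : checkL cls r tas = true) : checkL cls' r tas = true := by
  unfold checkL at h ⊢
  rw [List.all_eq_true] at h ⊢
  intro ta hta
  have h₁ := h ta hta
  rw [List.all_eq_true] at h₁ ⊢
  intro tb htb
  have h₂ := h₁ tb htb
  rw [List.all_eq_true] at h₂ ⊢
  intro tc htc
  have h₃ := h₂ tc htc
  rw [Bool.or_eq_true] at h₃ ⊢
  by_cases ha : cls' ta = true
  · by_cases hb : cls' tb = true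
    · by_cases hc : cls' tc = true
      · rcases h₃ with h₃ | h₃
        · left
          simp only [hsub ta ha, hsub tb hb, hsub tc hc, Bool.true_and] at h₃
          simp only [ha, hb, hc, Bool.true_and]
          exact h₃
        · exact Or.inr h₃
      · left; simp [hc]
    · left; simp [hb]
  · left; simp [ha]

/-- **Certificates serve sub-classes**: `check cls r → check cls' r` for every sub-class `cls' ⊆ cls`; combine with
`tsumP_nonneg_of_check` when the realised types of an instance lie in a smaller class than the certified one. [this work] -/
theorem check_mono {cls cls' : Ty → Bool} (hsub : ∀ t, cls' t = true → cls t = true) {r : Ty → Ty → Ty → ℤ}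
    (h : check cls r = true) : check cls' r = true :=
  checkL_mono hsub r tyList h

/-- **From a certificate on a super-class to the pinned sum**: if the checker accepts `r` on `cls` and every realised type
lies in a sub-class `cls' ⊆ cls`, then `tsumP r ≥ 0`. [this work] -/
theorem tsumP_nonneg_of_check_mono {ι : Type*} [Fintype ι] (𝒰 𝒱 𝒲 : Set (Set ι)) (e : ι) (τ : Set ι)
    {cls cls' : Ty → Bool} (hsub : ∀ t, cls' t = true → cls t = true) {r : Ty → Ty → Ty → ℤ}
    (h : check cls r = true) (hcls : ∀ w : Set ι, cls' (typ 𝒰 𝒱 𝒲 e w) = true) :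
    0 ≤ tsumP 𝒰 𝒱 𝒲 e τ r :=
  tsumP_nonneg_of_check 𝒰 𝒱 𝒲 e τ (check_mono hsub h) hcls

end Summit.CriticalPhenomena.PercolationContinuityZ3.Theorems.ThreePartition.TypedSlice
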